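import Summits.HubbardSuperconductivity.HubbardSuperconductivity.Theorems.AnisotropyChordTransferFibre3CapacityUpper
import Summits.HubbardSuperconductivity.HubbardSuperconductivity.Theorems.AnisotropyChordTransferFibre3ShellTermBounds

/-!
# Route `AnisotropyChord` / H0 rotor rung: the torus CAPACITY at the HOLE₂ point with the sharp leading constant — `G̃_{3ε₁/2}(0) ≤ H_{⌊L/2⌋}/(2π) + 0.76`, `Λ̃_L ≤ H_{⌊L/2⌋}/π + 1.52`

Second half of `…Fibre3CapacityUpper` (`G̃₀(0) ≤ H_{⌊L/2⌋}/(2π) + 0.23`): the λ-EXCESS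
`G̃_λ(0) − G̃₀(0) = (1/V)Σ_{k≠0} λ/(2ε(2ε−λ))` at the HOLE₂ point `λ = 3ε₁/2` (the walk resolvent at `¾ε₁`; p2's
`capT L (¾ε₁) = 2·Gres L (3ε₁/2) 0`):
* ★ `gres_excess_le_maj`: TERMWISE majorant — the first ring EXACTLY (`2ε = 2ε₁` on the axis points:
  `3/(2ε₁)`; `4ε₁` on the corners: `3/(20ε₁)`; p2's `epsT_shellOne/Two`), beyond it `λ/(E(E−λ)) ≤ (4λ/3)/E² = 2ε₁g₀² ≤
  4ε₁(A_m² + B²)` with the Taylor–Jordan bound `g₀ ≤ A_m + B`, `A_m = L²/(4π²|m|²)`, `B = π²/48`;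
* box sums `sum_box_maj12` (`= 33/(5ε₁)`), `sum_box_maj3` (`≤ 8ε₁(L²/4π²)²`, fourth-power ring count of
  `…RingCountUpper`), `sum_box_maj4`; `sum_excess_le`, ★ `Gres_lamH_sub_Gres_zero_le`;
* numerics (`L ≥ 8`, `π ∈ (3.14, 3.15)`, `ε₁L² ≥ 2π²(1 − π²/(6L²))² ≥ 18.7` from p1 g24's `eps1_ge_cubic`):
  `excess_ring_one_le` (`≤ .36`), `excess_far_le` (`≤ .1015`), `excess_const_le` (`≤ .067`) ⇒
  ★★ `Gres_lamH_le_Gres_zero_add`: **`G̃_{3ε₁/2}(0) ≤ G̃₀(0) + 0.53`** (truth `.386` at `L = 8`, `→ .357`);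
* ★★★ `Gres_lamH_zero_le_sharp`: **`G̃_{3ε₁/2}(0) ≤ H_{⌊L/2⌋}/(2π) + 0.76`**; ★★★ `two_Gres_lamH_zero_le_sharp`: in walk units
  **`Λ̃_L = 2G̃_{3ε₁/2}(0) ≤ H_{⌊L/2⌋}/π + 1.52`** (`L ≥ 8`; truth `≈ H/π + .85`; the crude tree bound is `4H_{⌊L/2⌋}`,
  ×12.6 in the slope) — the capacity UPPER bound consumed by p2's near-pair HOLE₂ tail (`dualCert_of_skeleton_capUpper`,
  margin `∝ κ_ζ/Λ_up`, so this constant moves the tail's starting `L₀` by `≈ √12`); `Gres_zero_le_sharp_of_le` (any `λ ≤ 3ε₁/2`).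
Prover seat `hubbard-h0-rotor-p1` g25; helper for stmt-HubbardSuperconductivity-19089 (`--supports`).
WHAT THIS IS NOT: nothing here proves superconductivity in the Hubbard model (rotor TARGET as worded stays FALSE, g15);
elementary lattice-sum bounds serving ONE input (capacity) of ONE input (HOLE₂) of ONE conditional reduction (rung 19089).
Mathlib + tree imports only; no sorry, no axioms.
-/

set_option linter.dupNamespace false
set_option autoImplicit false

noncomputable section

open scoped BigOperators
open Complex

namespace Summit.HubbardSuperconductivity.HubbardSuperconductivity.Theorems.AnisotropyChord.Transfer.Fibre3

variable (L : ℕ) [NeZero L]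

/-! ## The λ-excess termwise -/

/-- ★ TERMWISE MAJORANT of the λ-excess at `λ = 3ε₁/2` as a function of the representative `m(k)`: `3/(2ε₁)` on the
axis points of the first ring, `3/(20ε₁)` on its corners, `4ε₁(L²/(4π²|m|²))² (+ 4ε₁(π²/48)²)` beyond (`L ≥ 6`): the first ring exactly (`2ε = 2ε₁, 4ε₁`), beyond it
`λ/(E(E−λ)) ≤ (4λ/3)/E² = 2ε₁ g₀² ≤ 4ε₁(A_m² + B²)` with the Taylor–Jordan bound `g₀ ≤ A_m + B`. [folklore] -/
theorem gres_excess_le_maj (hL : 6 ≤ L) (k : Tor L) :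
    gres L (3 / 2 * eps1 L) k - gres L 0 k ≤
      (if k.1.valMinAbs.natAbs + k.2.valMinAbs.natAbs = 1 then 3 / (2 * eps1 L) else 0)
      + (if k.1.valMinAbs.natAbs = 1 ∧ k.2.valMinAbs.natAbs = 1 then 3 / (20 * eps1 L) else 0)
      + (if 2 ≤ k.1.valMinAbs.natAbs ∨ 2 ≤ k.2.valMinAbs.natAbs then
          4 * eps1 L * ((L : ℝ) ^ 2 / (4 * Real.pi ^ 2)
            * (1 / (((k.1.valMinAbs ^ 2 + k.2.valMinAbs ^ 2 : ℤ)) : ℝ))) ^ 2 else 0)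
      + (if ((k.1.valMinAbs, k.2.valMinAbs) : ℤ × ℤ) ≠ (0, 0) then 4 * eps1 L * (Real.pi ^ 2 / 48) ^ 2 else 0) := by
  have hε0 := (RateLemma.eps1_pos_of_two_le L (by omega)).le
  by_cases hk : k = 0
  · have : gres L (3 / 2 * eps1 L) k - gres L 0 k = 0 := by unfold gres; rw [if_pos hk, if_pos hk]; ring
    rw [this]
    have t1 : 0 ≤ (if k.1.valMinAbs.natAbs + k.2.valMinAbs.natAbs = 1 then 3 / (2 * eps1 L) else 0) := by
      split_ifs <;> positivity
    have t2 : 0 ≤ (if k.1.valMinAbs.natAbs = 1 ∧ k.2.valMinAbs.natAbs = 1 then 3 / (20 * eps1 L) else 0) := by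
      split_ifs <;> positivity
    have t3 : 0 ≤ (if 2 ≤ k.1.valMinAbs.natAbs ∨ 2 ≤ k.2.valMinAbs.natAbs then
          4 * eps1 L * ((L : ℝ) ^ 2 / (4 * Real.pi ^ 2)
            * (1 / (((k.1.valMinAbs ^ 2 + k.2.valMinAbs ^ 2 : ℤ)) : ℝ))) ^ 2 else 0) := by
      split_ifs <;> positivity
    have t4 : 0 ≤ (if ((k.1.valMinAbs, k.2.valMinAbs) : ℤ × ℤ) ≠ (0, 0) then
        4 * eps1 L * (Real.pi ^ 2 / 48) ^ 2 else 0) := by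
      split_ifs <;> positivity
    linarith
  have hε := RateLemma.eps1_pos_of_two_le L (by omega)
  have hεE := eps1_le_epsT L (by omega) hk
  have hE0 : 0 < 2 * epsT L k := by linarith
  have hEl : 3 / 2 * eps1 L < 2 * epsT L k := by linarith
  rw [gres_sub_gres_zero_eq L _ k hk hEl hE0]
  -- the representative is nonzero
  have hm0 : ¬ (k.1.valMinAbs.natAbs = 0 ∧ k.2.valMinAbs.natAbs = 0) := by
    intro h
    rw [Int.natAbs_eq_zero, Int.natAbs_eq_zero, ZMod.valMinAbs_eq_zero, ZMod.valMinAbs_eq_zero] at h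
    exact hk (Prod.ext h.1 h.2)
  have hne : ((k.1.valMinAbs, k.2.valMinAbs) : ℤ × ℤ) ≠ (0, 0) := by
    intro h
    simp only [Prod.mk.injEq, ZMod.valMinAbs_eq_zero] at h
    exact hk (Prod.ext h.1 h.2)
  have hB : 0 ≤ 4 * eps1 L * (Real.pi ^ 2 / 48) ^ 2 := by positivity
  rw [if_pos hne]
  rcases (show k.1.valMinAbs.natAbs + k.2.valMinAbs.natAbs = 1 ∨
      (k.1.valMinAbs.natAbs = 1 ∧ k.2.valMinAbs.natAbs = 1) ∨
      (2 ≤ k.1.valMinAbs.natAbs ∨ 2 ≤ k.2.valMinAbs.natAbs) by omega) with h1 | h2 | h3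
  · -- axis point of the first ring: `E = 2ε₁`
    have hE : epsT L k = eps1 L := RateLemma.epsT_shellOne L k h1
    rw [if_pos h1, if_neg (by omega), if_neg (by omega), hE]
    have e : 3 / 2 * eps1 L / (2 * eps1 L * (2 * eps1 L - 3 / 2 * eps1 L)) = 3 / (2 * eps1 L) := by
      field_simp; ring
    rw [e]; linarith
  · -- corner of the first ring: `E = 4ε₁`
    have hE : epsT L k = 2 * eps1 L := RateLemma.epsT_shellTwo L k h2
    rw [if_neg (by omega), if_pos h2, if_neg (by omega), hE]
    have e : 3 / 2 * eps1 L / (2 * (2 * eps1 L) * (2 * (2 * eps1 L) - 3 / 2 * eps1 L)) = 3 / (20 * eps1 L) := by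
      field_simp; ring
    rw [e]; linarith
  · -- beyond the first ring: `E ≥ 6ε₁`
    have hE6 := two_epsT_ge_six_eps1 L hL k h3
    rw [if_neg (by omega), if_neg (by omega), if_pos h3]
    set E := 2 * epsT L k with hEdef
    -- `λ/(E(E−λ)) ≤ 2ε₁/E²`
    have hden : 3 / 4 * E ≤ E - 3 / 2 * eps1 L := by linarith
    have step1 : 3 / 2 * eps1 L / (E * (E - 3 / 2 * eps1 L)) ≤ 3 / 2 * eps1 L / (E * (3 / 4 * E)) :=
      div_le_div_of_nonneg_left (by positivity) (by positivity) (mul_le_mul_of_nonneg_left hden hE0.le)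
    have step2 : 3 / 2 * eps1 L / (E * (3 / 4 * E)) = 2 * eps1 L * (1 / E) ^ 2 := by
      field_simp; ring
    -- `1/E = g₀(k) ≤ A_m + B`
    have hg0 : 1 / E = gres L 0 k := by unfold gres; rw [if_neg hk, sub_zero]
    have hT := gres_zero_le_taylor L k
    rw [← hg0] at hT
    set A := (L : ℝ) ^ 2 / (4 * Real.pi ^ 2) * (1 / ((((k.1.valMinAbs ^ 2 + k.2.valMinAbs ^ 2 : ℤ)) : ℝ))) with hA
    set B := Real.pi ^ 2 / 48 with hBdef
    have hA0 : 0 ≤ A := by rw [hA]; positivity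
    have hB0 : 0 ≤ B := by rw [hBdef]; positivity
    have hinv0 : 0 ≤ 1 / E := by positivity
    have hsq : (1 / E) ^ 2 ≤ 2 * A ^ 2 + 2 * B ^ 2 := by
      nlinarith [mul_le_mul hT hT hinv0 (by linarith), sq_nonneg (A - B)]
    calc 3 / 2 * eps1 L / (E * (E - 3 / 2 * eps1 L)) ≤ 2 * eps1 L * (1 / E) ^ 2 := by rw [← step2]; exact step1
      _ ≤ 2 * eps1 L * (2 * A ^ 2 + 2 * B ^ 2) := mul_le_mul_of_nonneg_left hsq (by positivity)
      _ = 0 + 0 + 4 * eps1 L * A ^ 2 + 4 * eps1 L * B ^ 2 := by ring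

/-! ## Summing the majorant over the punctured box -/

open RateLemma in
omit [NeZero L] in
/-- the first-ring part of the majorant sums to `4·3/(2ε₁) + 4·3/(20ε₁) = 33/(5ε₁)` over the first ring. [folklore] -/
theorem sum_ring_one_maj :
    ∑ m ∈ puncturedBox 1, ((if m.1.natAbs + m.2.natAbs = 1 then 3 / (2 * eps1 L) else 0)
      + (if m.1.natAbs = 1 ∧ m.2.natAbs = 1 then 3 / (20 * eps1 L) else 0)) = 33 / (5 * eps1 L) := by
  rw [puncturedBox_one_eq]
  rw [Finset.sum_insert (by decide), Finset.sum_insert (by decide), Finset.sum_insert (by decide),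
    Finset.sum_insert (by decide), Finset.sum_insert (by decide), Finset.sum_insert (by decide),
    Finset.sum_insert (by decide), Finset.sum_singleton]
  simp only [Int.natAbs_neg, Int.natAbs_one, Int.natAbs_zero]
  norm_num
  ring

open RateLemma in
omit [NeZero L] in
/-- ★ the first-ring part over any box `N ≥ 1`: exactly `33/(5ε₁)`. [folklore] -/
theorem sum_box_maj12 (N : ℕ) (hN : 1 ≤ N) :
    ∑ m ∈ puncturedBox N, ((if m.1.natAbs + m.2.natAbs = 1 then 3 / (2 * eps1 L) else 0)
      + (if m.1.natAbs = 1 ∧ m.2.natAbs = 1 then 3 / (20 * eps1 L) else 0)) = 33 / (5 * eps1 L) := by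
  rw [← Finset.sum_sdiff (puncturedBox_subset hN), sum_ring_one_maj]
  have h0 : ∑ m ∈ puncturedBox N \ puncturedBox 1, ((if m.1.natAbs + m.2.natAbs = 1 then 3 / (2 * eps1 L) else 0)
      + (if m.1.natAbs = 1 ∧ m.2.natAbs = 1 then 3 / (20 * eps1 L) else 0)) = 0 := by
    refine Finset.sum_eq_zero fun m hm => ?_
    obtain ⟨h1, h2, -, -⟩ := far_of_mem_sdiff hm
    rw [if_neg h1, if_neg h2, add_zero]
  rw [h0, zero_add]

open RateLemma in
omit [NeZero L] in
/-- ★ the far part of the majorant over the box `N ≥ 1`: `≤ 4ε₁(L²/4π²)²·2`. [folklore] -/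
theorem sum_box_maj3 (N : ℕ) (hN : 1 ≤ N) (hε : 0 ≤ eps1 L) :
    ∑ m ∈ puncturedBox N, (if 2 ≤ m.1.natAbs ∨ 2 ≤ m.2.natAbs then
        4 * eps1 L * ((L : ℝ) ^ 2 / (4 * Real.pi ^ 2) * (1 / (((m.1 ^ 2 + m.2 ^ 2 : ℤ)) : ℝ))) ^ 2 else 0)
      ≤ 4 * eps1 L * ((L : ℝ) ^ 2 / (4 * Real.pi ^ 2)) ^ 2 * 2 := by
  rw [← Finset.sum_sdiff (puncturedBox_subset hN)]
  have h1 : ∑ m ∈ puncturedBox 1, (if 2 ≤ m.1.natAbs ∨ 2 ≤ m.2.natAbs then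
        4 * eps1 L * ((L : ℝ) ^ 2 / (4 * Real.pi ^ 2) * (1 / (((m.1 ^ 2 + m.2 ^ 2 : ℤ)) : ℝ))) ^ 2 else 0) = 0 := by
    refine Finset.sum_eq_zero fun m hm => ?_
    rw [if_neg (not_far_of_mem_one hm)]
  have h2 : ∑ m ∈ puncturedBox N \ puncturedBox 1, (if 2 ≤ m.1.natAbs ∨ 2 ≤ m.2.natAbs then
        4 * eps1 L * ((L : ℝ) ^ 2 / (4 * Real.pi ^ 2) * (1 / (((m.1 ^ 2 + m.2 ^ 2 : ℤ)) : ℝ))) ^ 2 else 0)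
      = 4 * eps1 L * ((L : ℝ) ^ 2 / (4 * Real.pi ^ 2)) ^ 2
        * ∑ m ∈ puncturedBox N \ puncturedBox 1, (1 / (((m.1 ^ 2 + m.2 ^ 2 : ℤ)) : ℝ)) ^ 2 := by
    rw [Finset.mul_sum]
    refine Finset.sum_congr rfl fun m hm => ?_
    obtain ⟨-, -, h3, -⟩ := far_of_mem_sdiff hm
    rw [if_pos h3]
    ring
  rw [h1, h2, add_zero]
  have h3 := sum_sdiff_one_sq_le N hN
  have hNpos : (0 : ℝ) < N := by exact_mod_cast (show 0 < N by omega)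
  have h4 : ∑ m ∈ puncturedBox N \ puncturedBox 1, (1 / (((m.1 ^ 2 + m.2 ^ 2 : ℤ)) : ℝ)) ^ 2 ≤ 2 := by
    have : 0 < 4 / ((N : ℝ) * ((N : ℝ) + 1)) := by positivity
    linarith
  exact mul_le_mul_of_nonneg_left h4 (by positivity)

open RateLemma in
omit [NeZero L] in
/-- the constant part of the majorant over the box: `≤ 4N(N+1)·4ε₁(π²/48)²`. [folklore] -/
theorem sum_box_maj4 (N : ℕ) (hε : 0 ≤ eps1 L) :
    ∑ m ∈ puncturedBox N, (if m ≠ (0, 0) then 4 * eps1 L * (Real.pi ^ 2 / 48) ^ 2 else 0)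
      ≤ (4 * N * (N + 1) : ℕ) * (4 * eps1 L * (Real.pi ^ 2 / 48) ^ 2) := by
  have hle : ∀ m ∈ puncturedBox N, (if m ≠ (0, 0) then 4 * eps1 L * (Real.pi ^ 2 / 48) ^ 2 else 0)
      ≤ 4 * eps1 L * (Real.pi ^ 2 / 48) ^ 2 := by
    intro m _
    split_ifs
    · exact le_rfl
    · positivity
  have h := Finset.sum_le_card_nsmul _ _ _ hle
  rw [nsmul_eq_mul, card_puncturedBox] at h
  exact h

open RateLemma in
/-- ★ the λ-excess summed: `Σ_k (g_{3ε₁/2}(k) − g₀(k)) ≤ 33/(5ε₁) + 8ε₁(L²/4π²)² + 4N(N+1)·4ε₁(π²/48)²`, `N = ⌊L/2⌋`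
(`L ≥ 6`). [folklore] -/
theorem sum_excess_le (hL : 6 ≤ L) :
    ∑ k : Tor L, (gres L (3 / 2 * eps1 L) k - gres L 0 k)
      ≤ 33 / (5 * eps1 L) + 4 * eps1 L * ((L : ℝ) ^ 2 / (4 * Real.pi ^ 2)) ^ 2 * 2
        + (4 * (L / 2) * (L / 2 + 1) : ℕ) * (4 * eps1 L * (Real.pi ^ 2 / 48) ^ 2) := by
  have hε := (RateLemma.eps1_pos_of_two_le L (by omega)).le
  have hN : 1 ≤ L / 2 := by omega
  set F : ℤ × ℤ → ℝ := fun m =>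
    (if m.1.natAbs + m.2.natAbs = 1 then 3 / (2 * eps1 L) else 0)
      + (if m.1.natAbs = 1 ∧ m.2.natAbs = 1 then 3 / (20 * eps1 L) else 0)
      + (if 2 ≤ m.1.natAbs ∨ 2 ≤ m.2.natAbs then
          4 * eps1 L * ((L : ℝ) ^ 2 / (4 * Real.pi ^ 2) * (1 / (((m.1 ^ 2 + m.2 ^ 2 : ℤ)) : ℝ))) ^ 2 else 0)
      + (if m ≠ (0, 0) then 4 * eps1 L * (Real.pi ^ 2 / 48) ^ 2 else 0) with hF
  have h1 : ∑ k : Tor L, (gres L (3 / 2 * eps1 L) k - gres L 0 k)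
      ≤ ∑ k : Tor L, F (k.1.valMinAbs, k.2.valMinAbs) :=
    Finset.sum_le_sum fun k _ => gres_excess_le_maj L hL k
  have hFnn : ∀ m, 0 ≤ F m := by
    intro m
    have t1 : 0 ≤ (if m.1.natAbs + m.2.natAbs = 1 then 3 / (2 * eps1 L) else 0) := by
      split_ifs <;> positivity
    have t2 : 0 ≤ (if m.1.natAbs = 1 ∧ m.2.natAbs = 1 then 3 / (20 * eps1 L) else 0) := by
      split_ifs <;> positivity
    have t3 : 0 ≤ (if 2 ≤ m.1.natAbs ∨ 2 ≤ m.2.natAbs then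
        4 * eps1 L * ((L : ℝ) ^ 2 / (4 * Real.pi ^ 2) * (1 / (((m.1 ^ 2 + m.2 ^ 2 : ℤ)) : ℝ))) ^ 2 else 0) := by
      split_ifs <;> positivity
    have t4 : 0 ≤ (if m ≠ (0, 0) then 4 * eps1 L * (Real.pi ^ 2 / 48) ^ 2 else 0) := by
      split_ifs <;> positivity
    simp only [hF]
    linarith
  have hF0 : F (0, 0) = 0 := by simp [hF]
  have h2 := sum_rep_le_box_of_nonneg L F hFnn hF0
  have h3 : ∑ m ∈ puncturedBox (L / 2), F m
      = ∑ m ∈ puncturedBox (L / 2), ((if m.1.natAbs + m.2.natAbs = 1 then 3 / (2 * eps1 L) else 0)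
          + (if m.1.natAbs = 1 ∧ m.2.natAbs = 1 then 3 / (20 * eps1 L) else 0))
        + ∑ m ∈ puncturedBox (L / 2), (if 2 ≤ m.1.natAbs ∨ 2 ≤ m.2.natAbs then
          4 * eps1 L * ((L : ℝ) ^ 2 / (4 * Real.pi ^ 2) * (1 / (((m.1 ^ 2 + m.2 ^ 2 : ℤ)) : ℝ))) ^ 2 else 0)
        + ∑ m ∈ puncturedBox (L / 2), (if m ≠ (0, 0) then 4 * eps1 L * (Real.pi ^ 2 / 48) ^ 2 else 0) := by
    simp only [hF]
    rw [← Finset.sum_add_distrib, ← Finset.sum_add_distrib]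
  have h12 := sum_box_maj12 L (L / 2) hN
  have h4 := sum_box_maj3 L (L / 2) hN hε
  have h5 := sum_box_maj4 L (L / 2) hε
  linarith

/-! ## The capacity at the HOLE₂ point -/

/-- ★ the λ-excess at `λ = 3ε₁/2`:
`G̃_{3ε₁/2}(0) − G̃₀(0) ≤ (33/(5ε₁) + 8ε₁(L²/4π²)² + 4N(N+1)·4ε₁(π²/48)²)/L²`, `N = ⌊L/2⌋` (`L ≥ 6`). [folklore] -/
theorem Gres_lamH_sub_Gres_zero_le (hL : 6 ≤ L) :
    Gres L (3 / 2 * eps1 L) 0 - Gres L 0 0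
      ≤ (33 / (5 * eps1 L) + 4 * eps1 L * ((L : ℝ) ^ 2 / (4 * Real.pi ^ 2)) ^ 2 * 2
          + (4 * (L / 2) * (L / 2 + 1) : ℕ) * (4 * eps1 L * (Real.pi ^ 2 / 48) ^ 2)) / (L : ℝ) ^ 2 := by
  rw [Gres_zero_eq, Gres_zero_eq, ← sub_div, ← Finset.sum_sub_distrib]
  have hLpos : (0 : ℝ) < L := by exact_mod_cast (show 0 < L by omega)
  exact div_le_div_of_nonneg_right (sum_excess_le L hL) (by positivity)

omit [NeZero L] in
/-- numerics, first ring: `33/(5ε₁L²) ≤ 0.36` for `L ≥ 8` (`ε₁L² ≥ 2π²(1 − π²/(6L²))² ≥ 18.7`). [folklore] -/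
theorem excess_ring_one_le (hL : 8 ≤ L) : 33 / (5 * eps1 L) / (L : ℝ) ^ 2 ≤ 9 / 25 := by
  have hLpos : (0 : ℝ) < L := by exact_mod_cast (show 0 < L by omega)
  have hL8 : (8 : ℝ) ≤ L := by exact_mod_cast hL
  have hε := RateLemma.eps1_pos_of_two_le L (by omega)
  have hcub := eps1_ge_cubic L (by omega)
  have hπlo := Real.pi_gt_d2
  have hπhi := Real.pi_lt_d2
  have hπ2hi : Real.pi ^ 2 < 9.9225 := by nlinarith
  have hπ2lo : 9.8596 < Real.pi ^ 2 := by nlinarith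
  set x : ℝ := (Real.pi / L) ^ 2 with hx
  have hxe : x = Real.pi ^ 2 / (L : ℝ) ^ 2 := by rw [hx, div_pow]
  have hxle : x ≤ Real.pi ^ 2 / 64 := by
    rw [hxe]; apply div_le_div_of_nonneg_left (by positivity) (by norm_num); nlinarith
  have h1 : 0.974 ≤ 1 - x / 6 := by linarith
  have h2 : (0.974 : ℝ) ^ 2 ≤ (1 - x / 6) ^ 2 := pow_le_pow_left₀ (by norm_num) h1 2
  have hxL : x * (L : ℝ) ^ 2 = Real.pi ^ 2 := by rw [hxe]; field_simp
  have h3 : 18.7 ≤ eps1 L * (L : ℝ) ^ 2 := by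
    have := mul_le_mul_of_nonneg_right hcub (sq_nonneg (L : ℝ))
    have e : 2 * x * (1 - x / 6) ^ 2 * (L : ℝ) ^ 2 = 2 * (x * (L : ℝ) ^ 2) * (1 - x / 6) ^ 2 := by ring
    rw [e, hxL] at this
    nlinarith
  rw [div_div, show 5 * eps1 L * (L : ℝ) ^ 2 = 5 * (eps1 L * (L : ℝ) ^ 2) by ring,
    div_le_div_iff₀ (by positivity) (by norm_num)]
  nlinarith

omit [NeZero L] in
/-- numerics, far part: `8ε₁(L²/4π²)²/L² = ε₁L²/(2π⁴) ≤ 1/π² ≤ 0.1015`. [folklore] -/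
theorem excess_far_le (hL : 2 ≤ L) :
    4 * eps1 L * ((L : ℝ) ^ 2 / (4 * Real.pi ^ 2)) ^ 2 * 2 / (L : ℝ) ^ 2 ≤ 1015 / 10000 := by
  have hLpos : (0 : ℝ) < L := by exact_mod_cast (show 0 < L by omega)
  have hε := RateLemma.eps1_pos_of_two_le L hL
  have hup := RateLemma.eps1_le_half_theta_sq L
  have hπlo := Real.pi_gt_d2
  have hπ2lo : 9.8596 < Real.pi ^ 2 := by nlinarith
  have hπ : 0 < Real.pi := Real.pi_pos
  have hεL : eps1 L * (L : ℝ) ^ 2 ≤ 2 * Real.pi ^ 2 := by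
    have := mul_le_mul_of_nonneg_right hup (sq_nonneg (L : ℝ))
    have e : (2 * Real.pi / (L : ℝ)) ^ 2 / 2 * (L : ℝ) ^ 2 = 2 * Real.pi ^ 2 := by field_simp
    linarith
  have e : 4 * eps1 L * ((L : ℝ) ^ 2 / (4 * Real.pi ^ 2)) ^ 2 * 2 / (L : ℝ) ^ 2
      = eps1 L * (L : ℝ) ^ 2 / (2 * Real.pi ^ 4) := by
    field_simp; ring
  rw [e, div_le_div_iff₀ (by positivity) (by norm_num)]
  nlinarith [mul_le_mul_of_nonneg_right hεL (le_of_lt (by positivity : (0:ℝ) < Real.pi ^ 2))]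

omit [NeZero L] in
/-- numerics, constant part: `4N(N+1)·4ε₁(π²/48)²/L² ≤ (1 + 2/L)·8π²(π²/48)²/L² ≤ 0.067` (`L ≥ 8`). [folklore] -/
theorem excess_const_le (hL : 8 ≤ L) :
    (4 * (L / 2) * (L / 2 + 1) : ℕ) * (4 * eps1 L * (Real.pi ^ 2 / 48) ^ 2) / (L : ℝ) ^ 2 ≤ 67 / 1000 := by
  have hLpos : (0 : ℝ) < L := by exact_mod_cast (show 0 < L by omega)
  have hL8 : (8 : ℝ) ≤ L := by exact_mod_cast hL
  have hε := RateLemma.eps1_pos_of_two_le L (by omega)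
  have hup := RateLemma.eps1_le_half_theta_sq L
  have hπlo := Real.pi_gt_d2
  have hπhi := Real.pi_lt_d2
  have hπ : 0 < Real.pi := Real.pi_pos
  have hπ2hi : Real.pi ^ 2 < 9.9225 := by nlinarith
  have hπ6 : Real.pi ^ 6 < 977 := by
    have : Real.pi ^ 6 = (Real.pi ^ 2) ^ 3 := by ring
    rw [this]; nlinarith [pow_le_pow_left₀ (by positivity : (0:ℝ) ≤ Real.pi ^ 2) hπ2hi.le 3]
  -- `4N(N+1) ≤ L(L+2)`
  have hM : 2 * ((L / 2 : ℕ) : ℝ) ≤ L := by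
    have : 2 * (L / 2) ≤ L := Nat.mul_div_le L 2
    exact_mod_cast this
  have hM0 : (0 : ℝ) ≤ ((L / 2 : ℕ) : ℝ) := by positivity
  have hcard : ((4 * (L / 2) * (L / 2 + 1) : ℕ) : ℝ) ≤ (L : ℝ) * ((L : ℝ) + 2) := by
    push_cast
    nlinarith
  have hεL : eps1 L * (L : ℝ) ^ 2 ≤ 2 * Real.pi ^ 2 := by
    have := mul_le_mul_of_nonneg_right hup (sq_nonneg (L : ℝ))
    have e : (2 * Real.pi / (L : ℝ)) ^ 2 / 2 * (L : ℝ) ^ 2 = 2 * Real.pi ^ 2 := by field_simp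
    linarith
  have hB : 0 < 4 * eps1 L * (Real.pi ^ 2 / 48) ^ 2 := by positivity
  calc ((4 * (L / 2) * (L / 2 + 1) : ℕ) : ℝ) * (4 * eps1 L * (Real.pi ^ 2 / 48) ^ 2) / (L : ℝ) ^ 2
      ≤ (L : ℝ) * ((L : ℝ) + 2) * (4 * eps1 L * (Real.pi ^ 2 / 48) ^ 2) / (L : ℝ) ^ 2 :=
        div_le_div_of_nonneg_right (mul_le_mul_of_nonneg_right hcard hB.le) (by positivity)
    _ = (1 + 2 / (L : ℝ)) * (eps1 L * (L : ℝ) ^ 2) * Real.pi ^ 4 / (576 * (L : ℝ) ^ 2) := by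
        field_simp; ring
    _ ≤ (5 / 4) * (2 * Real.pi ^ 2) * Real.pi ^ 4 / (576 * (L : ℝ) ^ 2) := by
        apply div_le_div_of_nonneg_right _ (by positivity)
        have h12 : 1 + 2 / (L : ℝ) ≤ 5 / 4 := by
          have : 2 / (L : ℝ) ≤ 2 / 8 := div_le_div_of_nonneg_left (by norm_num) (by norm_num) hL8
          linarith
        exact mul_le_mul_of_nonneg_right (mul_le_mul h12 hεL (by positivity) (by norm_num)) (by positivity)
    _ = 10 * Real.pi ^ 6 / (2304 * (L : ℝ) ^ 2) := by ring
    _ ≤ 10 * Real.pi ^ 6 / (2304 * 64) := by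
        apply div_le_div_of_nonneg_left (by positivity) (by norm_num); nlinarith
    _ ≤ 67 / 1000 := by
        rw [div_le_div_iff₀ (by norm_num) (by norm_num)]; nlinarith

/-- ★★ **the λ-excess is at most `0.53`:** `G̃_{3ε₁/2}(0) ≤ G̃₀(0) + 0.53` (`L ≥ 8`; truth `.386` at `L = 8`, `→ .357`). [folklore] -/
theorem Gres_lamH_le_Gres_zero_add (hL : 8 ≤ L) : Gres L (3 / 2 * eps1 L) 0 ≤ Gres L 0 0 + 53 / 100 := by
  have h := Gres_lamH_sub_Gres_zero_le L (by omega)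
  rw [add_div, add_div] at h
  have ha := excess_ring_one_le L hL
  have hb := excess_far_le L (by omega)
  have hc := excess_const_le L hL
  linarith

/-- ★★★ **`G̃_{3ε₁/2}(0) ≤ H_{⌊L/2⌋}/(2π) + 0.76`** (`L ≥ 8`) — the torus Green's function at the origin at the HOLE₂ point,
with the sharp leading constant `1/(2π)` (truth `≈ H_{L/2}/(2π) + .52`). [folklore] -/
theorem Gres_lamH_zero_le_sharp (hL : 8 ≤ L) :
    Gres L (3 / 2 * eps1 L) 0 ≤ (harmonic (L / 2) : ℝ) / (2 * Real.pi) + 76 / 100 := by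
  have h1 := Gres_lamH_le_Gres_zero_add L hL
  have h2 := Gres_zero_zero_le_sharp' L (by omega)
  linarith

/-- ★★★ walk units (p2's `capT L (¾ε₁) = 2·Gres L (3ε₁/2) 0`): **`Λ̃_L = 2G̃_{3ε₁/2}(0) ≤ H_{⌊L/2⌋}/π + 1.52`** (`L ≥ 8`),
replacing the crude `4H_{⌊L/2⌋}` of `…TwoHoleBSTail.capT_le_harmonic` in `dualCert_of_skeleton_capUpper`
(truth `≈ H_{L/2}/π + .85`). Also valid for every `0 ≤ λ ≤ 3ε₁/2` by `Gres_zero_zero_mono`. [folklore] -/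
theorem two_Gres_lamH_zero_le_sharp (hL : 8 ≤ L) :
    2 * Gres L (2 * (3 / 4 * eps1 L)) 0 ≤ (harmonic (L / 2) : ℝ) / Real.pi + 152 / 100 := by
  have h := Gres_lamH_zero_le_sharp L hL
  rw [show 2 * (3 / 4 * eps1 L) = 3 / 2 * eps1 L by ring]
  have e : (harmonic (L / 2) : ℝ) / Real.pi = 2 * ((harmonic (L / 2) : ℝ) / (2 * Real.pi)) := by
    field_simp
  rw [e]
  linarith

/-- the same for any `λ ≤ 3ε₁/2` (monotonicity in `λ`). [folklore] -/
theorem Gres_zero_le_sharp_of_le (hL : 8 ≤ L) {lam2 : ℝ} (h1 : lam2 ≤ 3 / 2 * eps1 L) :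
    Gres L lam2 0 ≤ (harmonic (L / 2) : ℝ) / (2 * Real.pi) + 76 / 100 := by
  have hε := RateLemma.eps1_pos_of_two_le L (by omega)
  have hm := Gres_zero_zero_mono L (by omega) h1 (by linarith)
  exact hm.trans (Gres_lamH_zero_le_sharp L hL)

end Summit.HubbardSuperconductivity.HubbardSuperconductivity.Theorems.AnisotropyChord.Transfer.Fibre3

end
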